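import Mathlib.LinearAlgebra.DirectSum.Finsupp
import Mathlib.LinearAlgebra.Basis.Defs
import Mathlib.LinearAlgebra.Finsupp.Defs
import Mathlib.Algebra.Algebra.Basic
import Mathlib.Algebra.Module.BigOperators
import HarnessLib

/-!
# Extension of scalars to a free algebra of finite rank, in coordinates:
# `Λ₁ ⊗_Λ N ≃ N^ι` along a `Λ`-basis `(e_i)_{i ∈ ι}` of `Λ₁`, and the recognition principle
# "a `Λ₁`-module with such coordinates IS `Λ₁ ⊗_Λ N`"

Atiyah–Macdonald, *Introduction to Commutative Algebra*, Ch. 2: Prop. 2.14 (iii) `(M ⊕ N) ⊗ P ≅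
(M ⊗ P) ⊕ (N ⊗ P)`, (iv) `A ⊗ M ≅ M`, and "Restriction and extension of scalars" (p. 28): for
`f : A → B`, "`M_B = B ⊗_A M` carries a `B`-module structure such that `b(b' ⊗ x) = bb' ⊗ x`". For
`B = Λ₁` FREE over `A = Λ` with finite basis `e`, (iii)+(iv) give `Λ₁ ⊗_Λ N ≅ N^ι`, and the
`Λ₁`-structure is read in these coordinates through the regular-representation matrices
`(e.repr (s * e j) i)_{i,j}` of the elements `s ∈ Λ₁`.

* `tensorCoord e : Λ₁ ⊗[Λ] N ≃ₗ[Λ] (ι → N)`, `l ⊗ n ↦ (e.repr l i • n)_i` (Mathlib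
  `TensorProduct.finsuppScalarLeft`), and `tensorCoord_smul`: `coord (s • t) i = ∑_j e.repr (s * e j) i •
  coord t j`.
* **`linearEquivTensorOfCoords e E hE : P ≃ₗ[Λ₁] Λ₁ ⊗[Λ] N`** for ANY `Λ₁`-module `P` with an additive
  coordinate system `E : P ≃+ (ι → N)` in which every `s ∈ Λ₁` acts through its regular-representation
  matrix (`hE`). Used by `Literature/NumberTheory/EllipticCurves/Skinner2016/SelmerCoefficientBaseChange.lean`
  (`P` = a Selmer group with `𝒪₁`-coefficients, `N` = the Selmer group with `𝒪`-coefficients,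
  `Λ = 𝒪⟦T⟧`, `Λ₁ = 𝒪₁⟦T⟧`).

Definitions with bodies and proved lemmas; no named fact, no `sorry`, no instance, no notation.
-/

noncomputable section

open scoped TensorProduct

namespace Literature.LinearAlgebra.BaseChange

variable {Λ : Type*} [CommRing Λ] {Λ₁ : Type*} [CommRing Λ₁] [Algebra Λ Λ₁]
  {ι : Type*} [Fintype ι] (e : Module.Basis ι Λ Λ₁)
  {N : Type*} [AddCommGroup N] [Module Λ N]

/-- Coordinates of a product along a basis `e` of a commutative `Λ`-algebra `Λ₁`:
`e.repr (x * y) i = ∑_k e.repr x k * e.repr (e k * y) i`. [folklore] -/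
private theorem basis_repr_mul_eq_sum (x y : Λ₁) (i : ι) :
    e.repr (x * y) i = ∑ k, e.repr x k * e.repr (e k * y) i := by
  conv_lhs => rw [← e.sum_repr x, Finset.sum_mul]
  rw [map_sum, Finset.sum_apply']
  refine Finset.sum_congr rfl fun k _ ↦ ?_
  rw [smul_mul_assoc, map_smul, Finsupp.smul_apply, smul_eq_mul]

variable [DecidableEq ι]

/-- **`Λ₁ ⊗_Λ N ≃ N^ι` along a finite `Λ`-basis `e` of `Λ₁`** (`Λ`-linearly): `l ⊗ n ↦ (e.repr l i • n)_i`.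
[cite: AtiyahMacdonald1969, Ch. 2 Prop. 2.14 (iii), (iv) ((M ⊕ N) ⊗ P ≅ (M ⊗ P) ⊕ (N ⊗ P); A ⊗ M ≅ M)] -/
def tensorCoord : Λ₁ ⊗[Λ] N ≃ₗ[Λ] (ι → N) :=
  ((TensorProduct.congr e.repr (LinearEquiv.refl Λ N)).trans
    (TensorProduct.finsuppScalarLeft Λ N ι)).trans (Finsupp.linearEquivFunOnFinite Λ N ι)

/-- Coordinates of a pure tensor: `coord (l ⊗ n) i = e.repr l i • n`. [cite: AtiyahMacdonald1969, Ch. 2 Prop. 2.14 (iii), (iv)] -/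
@[simp] theorem tensorCoord_tmul (l : Λ₁) (n : N) (i : ι) :
    tensorCoord e (l ⊗ₜ[Λ] n) i = e.repr l i • n := by
  change Finsupp.linearEquivFunOnFinite Λ N ι
    (TensorProduct.finsuppScalarLeft Λ N ι (e.repr l ⊗ₜ[Λ] n)) i = _
  rw [Finsupp.linearEquivFunOnFinite_apply, TensorProduct.finsuppScalarLeft_apply_tmul_apply]

/-- **The `Λ₁`-structure "`b(b' ⊗ x) = bb' ⊗ x`" in coordinates is the regular representation of
`Λ₁` along `e`**: `coord (s • t) i = ∑_j e.repr (s * e j) i • coord t j`.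
[cite: AtiyahMacdonald1969, Ch. 2, "Restriction and extension of scalars" (p. 28: M_B carries a B-module structure such that b(b' ⊗ x) = bb' ⊗ x)] -/
theorem tensorCoord_smul (s : Λ₁) (t : Λ₁ ⊗[Λ] N) (i : ι) :
    tensorCoord e (s • t) i = ∑ j, e.repr (s * e j) i • tensorCoord e t j := by
  induction t using TensorProduct.induction_on with
  | zero => simp only [smul_zero, map_zero, Pi.zero_apply, Finset.sum_const_zero]
  | tmul l n =>
    rw [TensorProduct.smul_tmul', smul_eq_mul, tensorCoord_tmul]
    simp only [tensorCoord_tmul, smul_smul, ← Finset.sum_smul]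
    congr 1
    rw [mul_comm s l, basis_repr_mul_eq_sum e l s i]
    exact Finset.sum_congr rfl fun k _ ↦ by rw [mul_comm (e k) s, mul_comm]
  | add x y hx hy =>
    simp only [smul_add, map_add, Pi.add_apply, hx, hy, ← Finset.sum_add_distrib]

variable {P : Type*} [AddCommGroup P] [Module Λ₁ P] (E : P ≃+ (ι → N))
  (hE : ∀ (s : Λ₁) (x : P) (i : ι), E (s • x) i = ∑ j, e.repr (s * e j) i • E x j)

/-- **Recognition of an extension of scalars by coordinates.** A `Λ₁`-module `P` with an additive
coordinate system `E : P ≃ N^ι` in which every `s ∈ Λ₁` acts through its regular-representation matrix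
along the `Λ`-basis `e` of `Λ₁` is `Λ₁`-linearly isomorphic to `Λ₁ ⊗_Λ N` (compose `E` with
`tensorCoord e`; `Λ₁`-linearity because both sides carry `s` to the same matrix).
[cite: AtiyahMacdonald1969, Ch. 2 Prop. 2.14 (iii), (iv) and "Restriction and extension of scalars" (p. 28)] -/
def linearEquivTensorOfCoords : P ≃ₗ[Λ₁] Λ₁ ⊗[Λ] N :=
  { E.trans (tensorCoord (N := N) e).toAddEquiv.symm with
    map_smul' := fun s x ↦ by
      change (tensorCoord (N := N) e).symm (E (s • x)) = s • (tensorCoord (N := N) e).symm (E x)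
      apply (tensorCoord (N := N) e).injective
      rw [LinearEquiv.apply_symm_apply]
      funext i
      rw [hE, tensorCoord_smul]
      refine Finset.sum_congr rfl fun j _ ↦ ?_
      rw [LinearEquiv.apply_symm_apply] }

/-- Unfolding `linearEquivTensorOfCoords`: its coordinates are `E`. [cite: AtiyahMacdonald1969, Ch. 2 Prop. 2.14 (iii), (iv)] -/
@[simp] theorem tensorCoord_linearEquivTensorOfCoords (x : P) :
    tensorCoord e (linearEquivTensorOfCoords e E hE x) = E x := by
  change tensorCoord e ((tensorCoord (N := N) e).symm (E x)) = E x
  exact (tensorCoord (N := N) e).apply_symm_apply (E x)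

/-- Unfolding the inverse: `(linearEquivTensorOfCoords)⁻¹ t = E⁻¹ (coord t)`. [cite: AtiyahMacdonald1969, Ch. 2 Prop. 2.14 (iii), (iv)] -/
@[simp] theorem linearEquivTensorOfCoords_symm_apply (t : Λ₁ ⊗[Λ] N) :
    (linearEquivTensorOfCoords e E hE).symm t = E.symm (tensorCoord e t) := rfl

end Literature.LinearAlgebra.BaseChange
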